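import Literature.NumberTheory.Rogawski1990.Ch10Sec2to3
import HarnessLib

/-!
# Rogawski 1990, Chapter 10 — BRIDGE: the bookkeeping between the §10.1 ∕ §10.2 carpets (★ `Ch10Sec1`, ★ `Ch10Sec2to3`), the Chapter-7
# datum (★ `EllipticSingularTerms`) and the Chapter-5 sockets (★ `StabilisationIdentities`), PROVED (finite-sum algebra only; no new fact)
(J. D. Rogawski, *Automorphic Representations of Unitary Groups in Three Variables*, Ann. of Math. Studies 123 (1990), §10.1–§10.2
pp. 153–157 = held text chunks p0146–p0150; §5.2 pp. 68–69, chunks p0073–p0074.)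

Topic `NumberTheory/Rogawski1990`; namespace `Literature.NumberTheory.Rogawski1990.Ch10Bridge`.  THEOREMS ONLY (TR squad RULING #11: bridge
files import ★ only, add no definition and no `def … : Prop`, and prove the definitional ∕ finite-sum relations between parallel carriers).

* §0 (private plumbing) `finsum_sum_elim` — `Σᶠ_{α ⊕ β} = Σᶠ_α + Σᶠ_β` (finite supports); `finsum_fibres` — `Σᶠ_k Σᶠ_{i : π i = k} g i = Σᶠ_i g i` for a map
  `π` and `g` of finite support (the «sum over the classes `𝒪_st`, and for each over the `𝒪′_st` which transfer to `𝒪_st`» rearrangement).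
* §1 **`jG_eq_finsum_jclass`** — ★ `EllipticSingularData.JG f T = Σᶠ_{𝒪 : StClass 𝔇} Jclass 𝔇 f T 𝒪`: the §7.6 definition
  `J_G(f) = Σ J_G(𝒪_st, f)` regrouped over the single class index of ★ `Ch10Sec1` [§7.6 p. 111; §10.1 p. 153].
* §2 **`sjG_eq_jG_sub`** — under the class-transfer bookkeeping (a map `π : 𝒪′ ↦ 𝒪` realising `TransfersTo` — `exists_transferMap`
  extracts one from ★ `ClassTransferSpec` — and finite supports): `SJ_G(f) = J_G(f) − i(G, H)·SJ_H(f^H)`, i.e. summing the defining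
  equation «`J_G(𝒪_st, f) = SJ_G(𝒪_st, f) + i(G, H) Σ SJ_H(𝒪′_st, f^H)`» over `𝒪_st` gives (5.2.2) for `J_G` [§10.1 p. 153; §5.2 (5.2.2)
  p. 69]; **`sjG_eq_zero_of_prop1012Stable`** — the class-by-class stability (Prop. 10.1.2, first sentence) gives «`SJ_G(f)` is a stable
  distribution» (Prop. 10.1.1) [§10.1 p. 153].
* §3 **`eq1023_of_eq1021`** (and `eq522M_of_finite`) — (10.2.3) `Sθ_G + Sθ_M = SJ_G + ½ m(𝐙M\𝐌¹) Σ SJ^T_M` FOLLOWS from (10.2.1), the inductive identity for `H`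
  (`Sθ_H + Sθ_{M_H} = SJ_H + SJ_{M_H}`) and §2 — the print's «We subtract `i(G, H)` times (10.2.2) from (10.2.1) to obtain (10.2.3)»
  [§10.2 p. 157].
* §4 SOCKET AGREEMENT with ★ `StabilisationData` via ★ `LeviSpectralSide.stabData`: `HLeviIdentity` IS the `H`-identity, `Arthur521` IS
  (10.2.1) (`eq1021_iff_arthur521`); and at `i(G, H) = ½` (`G = U(3)`): `SθG`, `SθM`, `SJG` agree (`stabData_sθG`, `stabData_sθM`,
  `stabData_sjG`), THEOREM 10.3.1 (b) agrees (`thm1031b_iff`), and PROPOSITION 10.1.1 of the sockets follows from ★ `Prop1012Stable`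
  (`prop1011_stabData`) [§5.2 pp. 68–69; §10.2 p. 157; §10.3 p. 159].
No `sorry`, no new axiom, no instance, no notation, no definition, no new named fact.
-/

noncomputable section

namespace Literature.NumberTheory.Rogawski1990.Ch10Bridge

open Ch10Sec1 (StClass Jclass EndoscopicSide)
open Ch10Sec2to3 (LeviSpectralSide)

universe u u₁ u₂ u₃

/-! ## §0 Two finite-sum lemmas -/

/-- `Σᶠ` over a sum type splits as the two `Σᶠ`'s (finite supports); private plumbing. [folklore] -/
private theorem finsum_sum_elim {α β M : Type*} [AddCommMonoid M] (u : α → M) (v : β → M)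
    (hu : (Function.support u).Finite) (hv : (Function.support v).Finite) :
    ∑ᶠ c : α ⊕ β, Sum.elim u v c = (∑ᶠ a, u a) + ∑ᶠ b, v b := by
  have hs : (Set.range (Sum.inl : α → α ⊕ β) ∩ Function.support (Sum.elim u v)).Finite := by
    refine (hu.image Sum.inl).subset ?_
    rintro _ ⟨⟨a, rfl⟩, ha⟩
    exact ⟨a, ha, rfl⟩
  have ht : (Set.range (Sum.inr : β → α ⊕ β) ∩ Function.support (Sum.elim u v)).Finite := by
    refine (hv.image Sum.inr).subset ?_
    rintro _ ⟨⟨b, rfl⟩, hb⟩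
    exact ⟨b, hb, rfl⟩
  rw [← finsum_mem_univ, ← Set.range_inl_union_range_inr,
    finsum_mem_union' Set.isCompl_range_inl_range_inr.disjoint hs ht, finsum_mem_range Sum.inl_injective,
    finsum_mem_range Sum.inr_injective]
  rfl

/-- **Summation over fibres**: for a map `π : ι → κ` and `g` of finite support, `Σᶠ_k Σᶠ_{i : π i = k} g i = Σᶠ_i g i`; private
plumbing. [folklore] -/
private theorem finsum_fibres {ι κ M : Type*} [AddCommMonoid M] (π : ι → κ) (g : ι → M) (hg : (Function.support g).Finite) :
    ∑ᶠ k : κ, ∑ᶠ i : {i : ι // π i = k}, g i.1 = ∑ᶠ i, g i := by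
  classical
  set s := hg.toFinset with hs
  have hmem : ∀ i, i ∈ s ↔ g i ≠ 0 := fun i => by simp [hs]
  have hinner : ∀ k : κ, ∑ᶠ i : {i : ι // π i = k}, g i.1 = ∑ i ∈ s with π i = k, g i := by
    intro k
    rw [← Finset.sum_subtype_eq_sum_filter]
    apply finsum_eq_sum_of_support_subset
    intro i hi
    simpa [Finset.mem_subtype, hmem] using hi
  simp_rw [hinner]
  have hA : (Function.support fun k : κ => ∑ i ∈ s with π i = k, g i) ⊆ ↑(s.image π) := by
    intro k hk
    obtain ⟨i, hi, -⟩ := Finset.exists_ne_zero_of_sum_ne_zero hk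
    rw [Finset.mem_filter] at hi
    exact Finset.mem_coe.2 (Finset.mem_image.2 ⟨i, hi.1, hi.2⟩)
  have hB : Function.support g ⊆ ↑s := fun i hi => Finset.mem_coe.2 ((hmem i).2 hi)
  rw [finsum_eq_sum_of_support_subset _ hA, finsum_eq_sum_of_support_subset _ hB]
  exact Finset.sum_fiberwise_of_maps_to (fun i hi => Finset.mem_image_of_mem π hi) g

/-! ## §1 `J_G(f) = Σ_{𝒪_st} J_G(𝒪_st, f)` over the single class index -/

section Geometric

variable {TG : Type u₁} {TH : Type u₂}

/-- **`J_G(f) = Σᶠ_{𝒪 : StClass 𝔇} J_G(𝒪, f)`**: the §7.6 sum ★ `EllipticSingularData.JG` (regular classes + singular `γ ∈ Z\M`) regrouped over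
★ `Ch10Sec1.StClass` (finite supports, cf. ★ `EllipticSingularData.SumsFinite`). [cite: Rogawski1990, §7.6 p. 111; §10.1 p. 153, chunk p0146] -/
theorem jG_eq_finsum_jclass (𝔇 : EllipticSingularData.{u} TG) (f : TG) (T : ℝ)
    (hreg : (Function.support fun 𝒪 : 𝔇.EllReg => 𝔇.JTreg 𝒪 f T).Finite)
    (hsing : (Function.support fun γ : 𝔇.MZ => 𝔇.JGsing γ f T).Finite) :
    𝔇.JG f T = ∑ᶠ c : StClass 𝔇, Jclass 𝔇 f T c := by
  have hsing' : (Function.support fun γ : {γ : 𝔇.MZ // ¬ 𝔇.IsRegular γ} => 𝔇.JGsing γ.1 f T).Finite :=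
    (Set.Finite.preimage (f := (Subtype.val : {γ : 𝔇.MZ // ¬ 𝔇.IsRegular γ} → 𝔇.MZ))
      (s := Function.support fun γ : 𝔇.MZ => 𝔇.JGsing γ f T) Subtype.val_injective.injOn hsing).subset
      fun _ hx => hx
  rw [EllipticSingularData.JG, Jclass, finsum_sum_elim _ _ hreg hsing', ← finsum_set_coe_eq_finsum_mem]
  rfl

/-! ## §2 Summing the defining equation of `SJ_G(𝒪_st, f)`: `SJ_G(f) = J_G(f) − i(G, H) SJ_H(f^H)` -/

variable {𝔇 : EllipticSingularData.{u} TG} (ℰ : EndoscopicSide 𝔇 TH)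

/-- A class-transfer MAP `𝒪′ ↦ 𝒪` realising the relation `TransfersTo` exists under ★ `ClassTransferSpec` (every `𝒪′_st` transfers to
exactly one `𝒪_st`). [cite: Rogawski1990, §10.1 p. 153, chunk p0146] -/
theorem exists_transferMap (h : ℰ.ClassTransferSpec) :
    ∃ π : ℰ.CH → StClass 𝔇, ∀ (c' : ℰ.CH) (c : StClass 𝔇), ℰ.TransfersTo c' c ↔ π c' = c := by
  refine ⟨fun c' => (h.1 c').exists.choose, fun c' c => ?_⟩
  have hspec : ℰ.TransfersTo c' (h.1 c').exists.choose := (h.1 c').exists.choose_spec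
  exact ⟨fun hc => (h.1 c').unique hspec hc, fun hc => hc ▸ hspec⟩

/-- The endoscopic correction summed over the fibre of `𝒪` equals the sum over `{𝒪′ : π 𝒪′ = 𝒪}` for any map `π` realising `TransfersTo`.
[cite: Rogawski1990, §10.1 p. 153, chunk p0146] -/
theorem finsum_fibre_eq (π : ℰ.CH → StClass 𝔇) (hπ : ∀ c' c, ℰ.TransfersTo c' c ↔ π c' = c) (g : ℰ.CH → ℂ)
    (c : StClass 𝔇) : ∑ᶠ c' : {c' : ℰ.CH // ℰ.TransfersTo c' c}, g c'.1 = ∑ᶠ c' : {c' : ℰ.CH // π c' = c}, g c'.1 :=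
  finsum_eq_of_bijective (Equiv.subtypeEquivRight fun c' => hπ c' c) (Equiv.bijective _) fun _ => rfl

/-- **`SJ_G(f) = J_G(f) − i(G, H)·SJ_H(f^H)`** — the defining equation «`J_G(𝒪_st, f) = SJ_G(𝒪_st, f) + i(G, H) Σ_{𝒪′ ↦ 𝒪} SJ_H(𝒪′_st, f^H)`»
summed over the stable elliptic classes `𝒪_st` modulo `Z` (every `𝒪′_st` transfers to exactly one `𝒪_st`; finite supports): this is (5.2.2)
`J_G(f) = SJ_G(f) + i(G, H) SJ_H(f^H)`. [cite: Rogawski1990, §10.1 p. 153, chunk p0146; §5.2 (5.2.2) p. 69, chunk p0074] -/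
theorem sjG_eq_jG_sub (π : ℰ.CH → StClass 𝔇) (hπ : ∀ c' c, ℰ.TransfersTo c' c ↔ π c' = c) (f : TG) (fH : TH) (T : ℝ)
    (hreg : (Function.support fun 𝒪 : 𝔇.EllReg => 𝔇.JTreg 𝒪 f T).Finite)
    (hsing : (Function.support fun γ : 𝔇.MZ => 𝔇.JGsing γ f T).Finite)
    (hH : (Function.support fun c' : ℰ.CH => ℰ.SJH c' fH).Finite) :
    ℰ.SJG f fH T = 𝔇.JG f T - (ℰ.i : ℂ) * ℰ.SJHsum fH := by
  have hsing' : (Function.support fun γ : {γ : 𝔇.MZ // ¬ 𝔇.IsRegular γ} => 𝔇.JGsing γ.1 f T).Finite :=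
    (Set.Finite.preimage (f := (Subtype.val : {γ : 𝔇.MZ // ¬ 𝔇.IsRegular γ} → 𝔇.MZ))
      (s := Function.support fun γ : 𝔇.MZ => 𝔇.JGsing γ f T) Subtype.val_injective.injOn hsing).subset
      fun _ hx => hx
  have hJ : (Function.support fun c : StClass 𝔇 => Jclass 𝔇 f T c).Finite := by
    refine ((hreg.image Sum.inl).union (hsing'.image Sum.inr)).subset ?_
    rintro (𝒪 | γ) hc
    · exact Or.inl ⟨𝒪, hc, rfl⟩
    · exact Or.inr ⟨γ, hc, rfl⟩
  have hfib : ∀ c : StClass 𝔇, ∑ᶠ c' : {c' : ℰ.CH // ℰ.TransfersTo c' c}, ℰ.SJH c'.1 fH =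
      ∑ᶠ c' : {c' : ℰ.CH // π c' = c}, ℰ.SJH c'.1 fH := fun c => finsum_fibre_eq ℰ π hπ (fun c' => ℰ.SJH c' fH) c
  have hF : (Function.support fun c : StClass 𝔇 => ∑ᶠ c' : {c' : ℰ.CH // π c' = c}, ℰ.SJH c'.1 fH).Finite := by
    refine (hH.image π).subset fun c hc => ?_
    by_contra hnot
    apply hc
    refine finsum_eq_zero_of_forall_eq_zero fun c' => ?_
    by_contra h0
    exact hnot ⟨c'.1, h0, c'.2⟩
  have hF' : (Function.support fun c : StClass 𝔇 => (ℰ.i : ℂ) * ∑ᶠ c' : {c' : ℰ.CH // π c' = c}, ℰ.SJH c'.1 fH).Finite :=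
    hF.subset (Function.support_mul_subset_right _ _)
  simp only [EndoscopicSide.SJG, EndoscopicSide.SJclass, EndoscopicSide.SJHsum, hfib]
  rw [finsum_sub_distrib hJ hF', ← mul_finsum, finsum_fibres π (fun c' => ℰ.SJH c' fH) hH,
    jG_eq_finsum_jclass 𝔇 f T hreg hsing]

/-- **PROPOSITION 10.1.1 from the first sentence of PROPOSITION 10.1.2**: if every `SJ_G(𝒪_st, ·)` is stable (★ `Prop1012Stable`) then
`SJ_G(f) = Σ_{𝒪_st} SJ_G(𝒪_st, f)` vanishes on every `f` stably equivalent to zero («We have to show that `SJ_G(𝒪_st, f)` is stable»).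
[cite: Rogawski1990, §10.1 Prop. 10.1.1 (proof) p. 153, chunk p0146] -/
theorem sjG_eq_zero_of_prop1012Stable (h : ℰ.Prop1012Stable) (f : TG) (fH : TH) (T : ℝ) (htr : ℰ.transfer f fH)
    (hz : ℰ.StablyZero f) : ℰ.SJG f fH T = 0 :=
  finsum_eq_zero_of_forall_eq_zero fun c => h c f fH T htr hz

end Geometric

/-! ## §3 (10.2.3) from (10.2.1) and the `H`-identity -/

section LeviSpectral

variable {TG : Type u₁} {TH : Type u₂} {TΦ : Type u₃}
variable {𝔇 : TwistedEllipticSingularData.{u} TG TΦ} {ℰ : EndoscopicSide 𝔇.toEllipticSingularData TH}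
  (𝔏 : LeviSpectralSide 𝔇 ℰ)

/-- **(10.2.3) ⇐ (10.2.1) ∧ (`H`-identity) ∧ (`SJ_G = J_G − i SJ_H`)** — «We subtract `i(G, H)` times (10.2.2) from (10.2.1) to obtain (10.2.3)»:
with `Sθ_G := θ_G − i Sθ_H`, `Sθ_M := θ_M − i Sθ_{M_H}` (definitions (5.1.1), (5.2.2)), the inductively established identity
`Sθ_H + Sθ_{M_H} = SJ_H + SJ_{M_H}` for `H` (★ `StabilisationData.HLeviIdentity` shape) and §2's summed §10.1 equation, (10.2.3) holds.
[cite: Rogawski1990, §10.2 (10.2.3) p. 157, chunk p0149; §5.2 (5.2.3) p. 69] -/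
theorem eq1023_of_eq1021 (h21 : 𝔏.Eq1021)
    (hH : ∀ (fH : TH) (T : ℝ), 𝔏.SθH fH + 𝔏.SθMH fH T = ℰ.SJHsum fH + 𝔏.SJMHsum fH T)
    (hSJG : ∀ (f : TG) (fH : TH) (T : ℝ), ℰ.transfer f fH → ℰ.SJG f fH T = 𝔇.JG f T - (ℰ.i : ℂ) * ℰ.SJHsum fH)
    (hfin : ∀ (f : TG) (T : ℝ), (Function.support fun γ : 𝔇.MZ => 𝔇.JTM γ f T).Finite)
    (hfinH : ∀ (fH : TH) (T : ℝ), (Function.support fun γ : 𝔇.MZ => 𝔏.JTMH γ fH T).Finite) :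
    𝔏.Eq1023 := by
  intro f fH T htr
  have hfinH' : (Function.support fun γ : 𝔇.MZ => (ℰ.i : ℂ) * 𝔏.JTMH γ fH T).Finite :=
    (hfinH fH T).subset (Function.support_mul_subset_right _ _)
  have hsplit : ∑ᶠ γ : 𝔇.MZ, 𝔏.SJMT γ f fH T =
      (∑ᶠ γ : 𝔇.MZ, 𝔇.JTM γ f T) - (ℰ.i : ℂ) * ∑ᶠ γ : 𝔇.MZ, 𝔏.JTMH γ fH T := by
    simp only [LeviSpectralSide.SJMT]
    rw [finsum_sub_distrib (hfin f T) hfinH', mul_finsum]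
  have h1 := h21 f T
  have h2 := hH fH T
  rw [LeviSpectralSide.SJMHsum] at h2
  rw [LeviSpectralSide.SθG, LeviSpectralSide.SθM, hSJG f fH T htr, hsplit]
  linear_combination h1 - (ℰ.i : ℂ) * h2

/-- **«In particular (5.2.2) holds»** (★ `Eq522M`) is definitional bookkeeping: `J_M(f) = SJ_M(f) + i(G, H) SJ_{M_H}(f^H)` from the
definitions of `SJ^T_M`, `SJ_M`, `SJ_{M_H}` and ★ `EllipticSingularData.JM` (finite supports). [cite: Rogawski1990, §10.2 p. 157, chunk p0150;
§5.2 (5.2.2) p. 69] -/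
theorem eq522M_of_finite
    (hfin : ∀ (f : TG) (T : ℝ), (Function.support fun γ : 𝔇.MZ => 𝔇.JTM γ f T).Finite)
    (hfinH : ∀ (fH : TH) (T : ℝ), (Function.support fun γ : 𝔇.MZ => 𝔏.JTMH γ fH T).Finite) : 𝔏.Eq522M := by
  intro f fH T _
  have hfinH' : (Function.support fun γ : 𝔇.MZ => (ℰ.i : ℂ) * 𝔏.JTMH γ fH T).Finite :=
    (hfinH fH T).subset (Function.support_mul_subset_right _ _)
  simp only [LeviSpectralSide.SJM, LeviSpectralSide.SJMHsum, LeviSpectralSide.SJMT, EllipticSingularData.JM]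
  rw [finsum_sub_distrib (hfin f T) hfinH', ← mul_finsum]
  ring

/-! ## §4 Socket agreement with ★ `StabilisationData` (built by ★ `LeviSpectralSide.stabData`) -/

/-- The `H`-identity of the built ★ `StabilisationData` IS the hypothesis `hH` of `eq1023_of_eq1021`. [cite: Rogawski1990, §5.2 p. 69, chunk p0074] -/
theorem hLeviIdentity_stabData_iff (T : ℝ) :
    (𝔏.stabData T).HLeviIdentity ↔ ∀ fH : TH, 𝔏.SθH fH + 𝔏.SθMH fH T = ℰ.SJHsum fH + 𝔏.SJMHsum fH T :=
  Iff.rfl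

/-- (10.2.1) IS Arthur's identity (5.2.1) of the built sockets, `J_M(f) = ½ m(𝐙M\𝐌¹) Σ J^T_M(γ, f)` being ★ `EllipticSingularData.JM`.
[cite: Rogawski1990, §10.2 (10.2.1) p. 157, chunk p0149; §5.2 (5.2.1) p. 68] -/
theorem eq1021_iff_arthur521 : 𝔏.Eq1021 ↔ ∀ T : ℝ, (𝔏.stabData T).Arthur521 :=
  ⟨fun h T f => h f T, fun h f T => h T f⟩

/-- At `i(G, H) = ½` (`G = U(3)`, Prop. 5.3.1) the built sockets' `Sθ_G` is the carpet's `Sθ_G`. [cite: Rogawski1990, §5.2 (5.1.1) p. 68,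
chunk p0073] -/
theorem stabData_sθG (hi : ℰ.i = 1 / 2) (T : ℝ) (f : TG) (fH : TH) : (𝔏.stabData T).SθG f fH = 𝔏.SθG f fH := by
  simp [StabilisationData.SθG, LeviSpectralSide.SθG, LeviSpectralSide.stabData, hi]

/-- At `i(G, H) = ½` the built sockets' `Sθ_M` is the carpet's `Sθ_M`. [cite: Rogawski1990, §5.2 (5.2.2) p. 69, chunk p0074] -/
theorem stabData_sθM (hi : ℰ.i = 1 / 2) (T : ℝ) (f : TG) (fH : TH) : (𝔏.stabData T).SθM f fH = 𝔏.SθM f fH T := by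
  simp [StabilisationData.SθM, LeviSpectralSide.SθM, LeviSpectralSide.stabData, hi]

/-- At `i(G, H) = ½`, and given §2's summed §10.1 equation, the built sockets' `SJ_G(f) := J_G(f) − ½ SJ_H(f^H)` is the carpet's
`SJ_G(f) = Σ_{𝒪_st} SJ_G(𝒪_st, f)`. [cite: Rogawski1990, §10.1 p. 153, chunk p0146; §5.2 (5.2.2) p. 69] -/
theorem stabData_sjG (hi : ℰ.i = 1 / 2)
    (hSJG : ∀ (f : TG) (fH : TH) (T : ℝ), ℰ.transfer f fH → ℰ.SJG f fH T = 𝔇.JG f T - (ℰ.i : ℂ) * ℰ.SJHsum fH)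
    (T : ℝ) (f : TG) (fH : TH) (htr : ℰ.transfer f fH) : (𝔏.stabData T).SJG f fH = ℰ.SJG f fH T := by
  rw [hSJG f fH T htr, hi, StabilisationData.SJG]
  simp [LeviSpectralSide.stabData]

/-- **THEOREM 10.3.1 (b), both typings agree** at `i(G, H) = ½`: ★ `StabilisationData.Thm1031b` of the built sockets ↔ ★
`LeviSpectralSide.Thm1031b`. [cite: Rogawski1990, §10.3 Thm. 10.3.1 (b) p. 159, chunk p0150] -/
theorem thm1031b_iff (hi : ℰ.i = 1 / 2) (T : ℝ) : (𝔏.stabData T).Thm1031b ↔ 𝔏.Thm1031b := by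
  constructor
  · intro h f fH htr hz
    rw [← stabData_sθG 𝔏 hi T f fH]
    exact h f fH htr hz
  · intro h f fH htr hz
    rw [stabData_sθG 𝔏 hi T f fH]
    exact h f fH htr hz

/-- **PROPOSITION 10.1.1 for the built sockets from the class-by-class stability** (★ `Prop1012Stable`), at `i(G, H) = ½` and given §2's
summed equation. [cite: Rogawski1990, §10.1 Prop. 10.1.1 p. 153, chunk p0146] -/
theorem prop1011_stabData (hi : ℰ.i = 1 / 2) (h : ℰ.Prop1012Stable)
    (hSJG : ∀ (f : TG) (fH : TH) (T : ℝ), ℰ.transfer f fH → ℰ.SJG f fH T = 𝔇.JG f T - (ℰ.i : ℂ) * ℰ.SJHsum fH) (T : ℝ) :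
    (𝔏.stabData T).Prop1011 := by
  intro f fH htr hz
  rw [stabData_sjG 𝔏 hi hSJG T f fH htr]
  exact sjG_eq_zero_of_prop1012Stable ℰ h f fH T htr hz

end LeviSpectral

end Literature.NumberTheory.Rogawski1990.Ch10Bridge

end
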